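import Summits.AnomalousDissipation.AnomalousDissipation.Theorems.MomentParityQuarticGateDesignRowSums
import Summits.AnomalousDissipation.AnomalousDissipation.Theorems.QuarticGate.Negative.LevelCeiling

/-!
# The explicit order-2 design: rows summed over the atoms

Helper file for stub S6′ (`stub_order2DesignSym`) of the line `axis-sectors` of crux
`MomentParity.QuarticGate`, continuing `MomentParityQuarticGateDesignSums` /
`MomentParityQuarticGateDesignBudget` (same coefficient families `cf, cA, cB, cC, cR`, passed as
variables with defining hypotheses). For atoms `U p ∈ H` represented a.e. by the real trigonometric
polynomials of the design and a force `f` with Fourier coefficients `cf` (the Kolmogorov force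
`cos(2πx₁) e₀`, which is also the mean flow), this file sums the per-atom row formulas of
`MomentParityQuarticGateAtomRows` over the design index set `ι = Fin 4 × FrameIdx × Bool × Bool`
(the sibling `MomentParityQuarticGateDesignRowSums` does this for the concrete level-`N` polynomial
force; here the force is abstracted to `f` with coefficients `cf`, the form needed by the symmetric
stub, and the nondegeneracy device is imported from the sibling):
the LINEAR rows vanish as soon as `π A₁ B₂ = 1 - 4π²ν`, the ENERGY row is an explicit affine function
of the enstrophy budget, the HELICITY row vanishes identically, and two atoms differing in the sign
of the noise mode `cR a` are separated by every band test pairing non-trivially with the frame field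
`a` (the nondegenerate covariance).
-/

namespace Summit.AnomalousDissipation.AnomalousDissipation.Theorems.MomentParityQuarticGate

open MeasureTheory Filter Complex
open scoped InnerProductSpace RealInnerProductSpace ComplexConjugate
open Literature.Analysis.FunctionSpaces Literature.Analysis.FluidPDE
open Summit.AnomalousDissipation.AnomalousDissipation.Theorems.QuarticGate.Negative

set_option linter.dupNamespace false

noncomputable section

/-! ## Finite Fourier-side bookkeeping -/

/-- Swapping a finite sum of coefficient families through the pairing form
`c ↦ ∑_{k∈S} Re ⟪c k, v k⟫`. [folklore] -/
theorem sum_sum_re_inner_apply {ι : Type*} (s : Finset ι) (S : Finset (Fin 3 → ℤ))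
    (x : ι → (Fin 3 → ℤ) → EuclideanSpace ℂ (Fin 3)) (v : (Fin 3 → ℤ) → EuclideanSpace ℂ (Fin 3)) :
    ∑ p ∈ s, ∑ k ∈ S, (inner ℂ (x p k) (v k)).re = ∑ k ∈ S, (inner ℂ ((∑ p ∈ s, x p) k) (v k)).re := by
  rw [Finset.sum_comm]
  refine Finset.sum_congr rfl fun k _ => ?_
  rw [Finset.sum_apply, sum_inner, Complex.re_sum]

/-- Swapping a finite sum of coefficient families through the pairing form in the second slot.
[folklore] -/
theorem sum_sum_re_inner_apply_right {ι : Type*} (s : Finset ι) (S : Finset (Fin 3 → ℤ))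
    (v : (Fin 3 → ℤ) → EuclideanSpace ℂ (Fin 3)) (x : ι → (Fin 3 → ℤ) → EuclideanSpace ℂ (Fin 3)) :
    ∑ p ∈ s, ∑ k ∈ S, (inner ℂ (v k) (x p k)).re = ∑ k ∈ S, (inner ℂ (v k) ((∑ p ∈ s, x p) k)).re := by
  rw [Finset.sum_comm]
  refine Finset.sum_congr rfl fun k _ => ?_
  rw [Finset.sum_apply, inner_sum, Complex.re_sum]

/-- A real scalar moves through the complex pairing form: `Re ⟪r • x, y⟫ = r Re ⟪x, y⟫`. [folklore] -/
theorem re_inner_ofReal_smul_left (r : ℝ) (x y : EuclideanSpace ℂ (Fin 3)) :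
    (inner ℂ (((r : ℝ) : ℂ) • x) y).re = r * (inner ℂ x y).re := by
  rw [inner_smul_left, Complex.conj_ofReal, Complex.re_ofReal_mul]

section Rows

variable {N : ℕ} {A₁ B₂ c η : ℝ}
  {cf cC : (Fin 3 → ℤ) → EuclideanSpace ℂ (Fin 3)} {cA cB : Fin 4 → (Fin 3 → ℤ) → EuclideanSpace ℂ (Fin 3)}
  {cR : Torus.FrameIdx (Fin 3) N → (Fin 3 → ℤ) → EuclideanSpace ℂ (Fin 3)}
  (hcf : cf = (Pi.single (![0, 1, 0] : Fin 3 → ℤ) (((1 / 2 : ℂ)) • EuclideanSpace.complexify (WithLp.toLp 2 ![(1 : ℝ), 0, 0] : EuclideanSpace ℝ (Fin 3))) +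
        Pi.single (-(![0, 1, 0] : Fin 3 → ℤ)) ((starRingEnd ℂ) ((1 / 2 : ℂ)) • EuclideanSpace.complexify (WithLp.toLp 2 ![(1 : ℝ), 0, 0] : EuclideanSpace ℝ (Fin 3))) : (Fin 3 → ℤ) → EuclideanSpace ℂ (Fin 3)))
  (hcA : cA = fun m : Fin 4 => (Pi.single (![0, 0, 1] : Fin 3 → ℤ) ((((A₁ / 2 : ℝ) : ℂ) * Complex.I ^ (m : ℕ)) • EuclideanSpace.complexify (WithLp.toLp 2 ![(1 : ℝ), 0, 0] : EuclideanSpace ℝ (Fin 3))) +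
        Pi.single (-(![0, 0, 1] : Fin 3 → ℤ)) ((starRingEnd ℂ) (((A₁ / 2 : ℝ) : ℂ) * Complex.I ^ (m : ℕ)) • EuclideanSpace.complexify (WithLp.toLp 2 ![(1 : ℝ), 0, 0] : EuclideanSpace ℝ (Fin 3))) : (Fin 3 → ℤ) → EuclideanSpace ℂ (Fin 3)))
  (hcB : cB = fun m : Fin 4 => (Pi.single (![0, 1, 1] : Fin 3 → ℤ) ((((B₂ / 2 : ℝ) : ℂ) * -Complex.I * Complex.I ^ (m : ℕ)) • EuclideanSpace.complexify (WithLp.toLp 2 ![(0 : ℝ), 1, -1] : EuclideanSpace ℝ (Fin 3))) +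
        Pi.single (-(![0, 1, 1] : Fin 3 → ℤ)) ((starRingEnd ℂ) (((B₂ / 2 : ℝ) : ℂ) * -Complex.I * Complex.I ^ (m : ℕ)) • EuclideanSpace.complexify (WithLp.toLp 2 ![(0 : ℝ), 1, -1] : EuclideanSpace ℝ (Fin 3))) : (Fin 3 → ℤ) → EuclideanSpace ℂ (Fin 3)))
  (hcC : cC = (Pi.single (![0, 0, (N : ℤ)] : Fin 3 → ℤ) ((((c / 2 : ℝ) : ℂ)) • EuclideanSpace.complexify (WithLp.toLp 2 ![(1 : ℝ), 0, 0] : EuclideanSpace ℝ (Fin 3))) +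
        Pi.single (-(![0, 0, (N : ℤ)] : Fin 3 → ℤ)) ((starRingEnd ℂ) (((c / 2 : ℝ) : ℂ)) • EuclideanSpace.complexify (WithLp.toLp 2 ![(1 : ℝ), 0, 0] : EuclideanSpace ℝ (Fin 3))) : (Fin 3 → ℤ) → EuclideanSpace ℂ (Fin 3)))
  (hcR : cR = fun a : Torus.FrameIdx (Fin 3) N => (Pi.single (a.1 : Fin 3 → ℤ) ((((η / 2 : ℝ) : ℂ) * (if a.2.2 then (1 : ℂ) else -Complex.I)) • EuclideanSpace.complexify (Torus.perpVec (a.1 : Fin 3 → ℤ) a.2.1)) +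
        Pi.single (-(a.1 : Fin 3 → ℤ)) ((starRingEnd ℂ) (((η / 2 : ℝ) : ℂ) * (if a.2.2 then (1 : ℂ) else -Complex.I)) • EuclideanSpace.complexify (Torus.perpVec (a.1 : Fin 3 → ℤ) a.2.1)) : (Fin 3 → ℤ) → EuclideanSpace ℂ (Fin 3)))
  {U : (Fin 4 × Torus.FrameIdx (Fin 3) N × Bool × Bool) → Torus.energySpace (Fin 3)}
  (hU : ∀ p, (((U p).1 : Lp (EuclideanSpace ℝ (Fin 3)) 2 (volume : Measure (UnitAddTorus (Fin 3)))) :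
      UnitAddTorus (Fin 3) → EuclideanSpace ℝ (Fin 3)) =ᵐ[volume]
    Torus.realTrigPoly ((Torus.freqBall N).erase 0)
      (cf + cA p.1 + cB p.1 + (if p.2.2.1 then (1 : ℝ) else -1) • cC + (if p.2.2.2 then (1 : ℝ) else -1) • cR p.2.1))
  {f : UnitAddTorus (Fin 3) → EuclideanSpace ℝ (Fin 3)} (hf : Torus.IsSmooth f)
  (hfF : ∀ k, UnitAddTorus.mFourierCoeff (EuclideanSpace.complexify ∘ f) k = cf k)

/-! ## The force mode -/

include hcf in
/-- **The Stokes multiplier acts on the force mode as `-4π²`**: `Re ⟪cf k, (-4π²|k|²) • y⟫ =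
-4π² Re ⟪cf k, y⟫` (`cf` lives on `±(0,1,0)`, where `|k|² = 1`). [folklore] -/
theorem design_re_inner_cf_stokes (k : Fin 3 → ℤ) (y : EuclideanSpace ℂ (Fin 3)) :
    (inner ℂ (cf k) ((-(((4 * Real.pi ^ 2 * Torus.freqNormSq k : ℝ) : ℂ))) • y)).re =
      -(4 * Real.pi ^ 2) * (inner ℂ (cf k) y).re := by
  obtain ⟨hF, -, -, -⟩ := design_freqNormSq 0
  have key : Torus.freqNormSq k = 1 ∨ cf k = 0 := by
    by_cases h1 : k = (![0, 1, 0] : Fin 3 → ℤ)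
    · exact Or.inl (by rw [h1, hF])
    by_cases h2 : k = -(![0, 1, 0] : Fin 3 → ℤ)
    · exact Or.inl (by rw [h2, Torus.freqNormSq_neg, hF])
    subst hcf
    exact Or.inr (single_add_single_apply_eq_zero h1 h2 _ _)
  rcases key with h | h
  · rw [h, mul_one, inner_smul_right, ← Complex.ofReal_neg, Complex.re_ofReal_mul]
  · rw [h, inner_zero_left, inner_zero_left, Complex.zero_re, mul_zero]

include hcf in
/-- **Energy of the force mode**: `∑_{k∈S} Re ⟪cf k, cf k⟫ = 1/2`. [folklore] -/
theorem design_sum_re_inner_cf_cf (hN : 2 ≤ N) :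
    ∑ k ∈ ((Torus.freqBall N).erase 0), (inner ℂ (cf k) (cf k)).re = 1 / 2 := by
  obtain ⟨hkF, hnkF, -⟩ := design_mem hN
  obtain ⟨hF0, -⟩ := design_freq_facts
  obtain ⟨ne, -, n1, -⟩ := design_norms 0 0 0 0 0 true
  have h : ∑ k ∈ ((Torus.freqBall N).erase 0), (inner ℂ (cf k) (cf k)).re =
      ∑ k ∈ ((Torus.freqBall N).erase 0), ‖cf k‖ ^ 2 := Finset.sum_congr rfl fun k _ => by
    have := inner_self_eq_norm_sq (𝕜 := ℂ) (cf k)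
    rwa [RCLike.re_to_complex] at this
  rw [h, hcf, sum_norm_sq_polarised hkF hnkF hF0, n1, ne]
  norm_num

include hf hfF in
/-- **The force pairs with a band test through the force mode**: `(f, g) = ∑_{k∈S} Re ⟪cf k, ĝ k⟫`.
[folklore] -/
theorem design_integral_inner_force {g : UnitAddTorus (Fin 3) → EuclideanSpace ℝ (Fin 3)} (hg : IsBandTest N g) :
    ∫ x, ⟪f x, g x⟫_ℝ = ∑ k ∈ ((Torus.freqBall N).erase 0),
      (inner ℂ (cf k) (UnitAddTorus.mFourierCoeff (EuclideanSpace.complexify ∘ g) k)).re := by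
  rw [Torus.integral_inner_eq_sum_of_band_limited (hf.memLp 2) (hg.1.memLp 2) hg.2.2.2]
  simp_rw [hfF]

/-! ## The linear rows -/

include hcf hcA hcB hcC hcR hU hf hfF in
/-- **THE LINEAR ROWS OF THE DESIGN VANISH** once `π A₁ B₂ = 1 - 4π²ν`: summed over the atoms, the
row of a band test `g` is `#ι · (1 - 4π²ν - πA₁B₂) · ∑ Re⟪cf k, ĝ k⟫` (force + Stokes term of the mean
flow + Reynolds stress of the correlated pair, all proportional to the force mode). [folklore] -/
theorem symDesign_sum_linearRow (hN : 2 ≤ N) (ν : ℝ) (hAB : Real.pi * A₁ * B₂ = 1 - 4 * Real.pi ^ 2 * ν)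
    {g : UnitAddTorus (Fin 3) → EuclideanSpace ℝ (Fin 3)} (hg : IsBandTest N g) :
    ∑ p, Torus.nsGeneratorPairing ν f (U p) g = 0 := by
  have hrow : ∀ p, Torus.nsGeneratorPairing ν f (U p) g = (∫ x, ⟪f x, g x⟫_ℝ) +
      ν * ∑ k ∈ (Torus.freqBall N).erase 0,
        (inner ℂ (-(((4 * Real.pi ^ 2 * Torus.freqNormSq k : ℝ) : ℂ) •
          (cf + cA p.1 + cB p.1 + (if p.2.2.1 then (1 : ℝ) else -1) • cC + (if p.2.2.2 then (1 : ℝ) else -1) • cR p.2.1) k))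
          (UnitAddTorus.mFourierCoeff (EuclideanSpace.complexify ∘ g) k)).re -
      ∑ k ∈ (Torus.freqBall N).erase 0,
        (inner ℂ (Torus.convectionCoeff ((Torus.freqBall N).erase 0)
          (cf + cA p.1 + cB p.1 + (if p.2.2.1 then (1 : ℝ) else -1) • cC + (if p.2.2.2 then (1 : ℝ) else -1) • cR p.2.1)
          (cf + cA p.1 + cB p.1 + (if p.2.2.1 then (1 : ℝ) else -1) • cC + (if p.2.2.2 then (1 : ℝ) else -1) • cR p.2.1) k)
          (UnitAddTorus.mFourierCoeff (EuclideanSpace.complexify ∘ g) k)).re :=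
    fun p => nsGeneratorPairing_of_ae_eq (hU p) (design_isConjSymm hcf hcA hcB hcC hcR p)
      (design_isTransversal hcf hcA hcB hcC hcR p) ν f hg.1 hg.2.2.2
  simp_rw [hrow]
  rw [Finset.sum_sub_distrib, Finset.sum_add_distrib, Finset.sum_const, Finset.card_univ, ← Finset.mul_sum,
    nsmul_eq_mul]
  -- the Stokes term: move the real multiplier to the right slot and sum the atoms
  have hstokes : ∀ (x : (Fin 3 → ℤ) → EuclideanSpace ℂ (Fin 3)) (k : Fin 3 → ℤ),
      (inner ℂ (-(((4 * Real.pi ^ 2 * Torus.freqNormSq k : ℝ) : ℂ) • x k))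
        (UnitAddTorus.mFourierCoeff (EuclideanSpace.complexify ∘ g) k)).re =
      (inner ℂ (x k) ((-(((4 * Real.pi ^ 2 * Torus.freqNormSq k : ℝ) : ℂ))) •
        UnitAddTorus.mFourierCoeff (EuclideanSpace.complexify ∘ g) k)).re := fun x k => by
    rw [inner_neg_left, inner_smul_left, Complex.conj_ofReal, neg_smul, inner_neg_right, inner_smul_right]
  simp_rw [hstokes]
  rw [sum_sum_re_inner_apply Finset.univ, sum_sum_re_inner_apply Finset.univ,
    design_sum_atoms (cf := cf) (cC := cC) (cR := cR) hcA hcB, design_sum_convectionCoeff hcf hcA hcB hcC hcR hN,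
    design_integral_inner_force hf hfF hg]
  -- everything is a multiple of `T = ∑ Re⟪cf k, ĝ k⟫`
  set T := ∑ k ∈ (Torus.freqBall N).erase 0,
    (inner ℂ (cf k) (UnitAddTorus.mFourierCoeff (EuclideanSpace.complexify ∘ g) k)).re with hT
  set n : ℝ := ((Fintype.card (Fin 4 × Torus.FrameIdx (Fin 3) N × Bool × Bool) : ℕ) : ℝ) with hn
  have h1 : ∑ k ∈ (Torus.freqBall N).erase 0,
      (inner ℂ ((n • cf) k) ((-(((4 * Real.pi ^ 2 * Torus.freqNormSq k : ℝ) : ℂ))) •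
        UnitAddTorus.mFourierCoeff (EuclideanSpace.complexify ∘ g) k)).re = n * (-(4 * Real.pi ^ 2)) * T := by
    rw [hT, Finset.mul_sum]
    refine Finset.sum_congr rfl fun k _ => ?_
    rw [Pi.smul_apply, ← Complex.coe_smul, re_inner_ofReal_smul_left, design_re_inner_cf_stokes hcf, mul_assoc]
  have h2 : ∑ k ∈ (Torus.freqBall N).erase 0,
      (inner ℂ (((n * (Real.pi * A₁ * B₂)) • cf) k) (UnitAddTorus.mFourierCoeff (EuclideanSpace.complexify ∘ g) k)).re =
      (n * (Real.pi * A₁ * B₂)) * T := by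
    rw [hT, Finset.mul_sum]
    refine Finset.sum_congr rfl fun k _ => ?_
    rw [Pi.smul_apply, ← Complex.coe_smul, re_inner_ofReal_smul_left]
  rw [h1, h2]
  have : n * T + ν * (n * -(4 * Real.pi ^ 2) * T) - n * (Real.pi * A₁ * B₂) * T =
      n * T * (1 - 4 * Real.pi ^ 2 * ν - Real.pi * A₁ * B₂) := by ring
  rw [this, hAB]
  ring

/-! ## The energy row -/

include hcf hcA hcB hcC hcR hU hf hfF in
/-- **THE ENERGY ROW OF THE DESIGN, summed over the atoms**:
`∑ₚ ⟨F(Uₚ), P_N Uₚ⟩ = #ι/2 - 4π²ν (#ι (1/2 + A₁²/2 + 2B₂² + N²c²/2) + 16 ∑ₐ ∑ |k|² ‖cR a k‖²)`. [folklore] -/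
theorem symDesign_sum_energyRow (hN : 2 ≤ N) (ν : ℝ) :
    ∑ p, Torus.nsGeneratorPairing ν f (U p) (Torus.fourierTruncate N
      (((U p).1 : Lp (EuclideanSpace ℝ (Fin 3)) 2 (volume : Measure (UnitAddTorus (Fin 3)))) :
        UnitAddTorus (Fin 3) → EuclideanSpace ℝ (Fin 3))) =
      ((Fintype.card (Fin 4 × Torus.FrameIdx (Fin 3) N × Bool × Bool) : ℕ) : ℝ) * (1 / 2) -
        ν * (4 * Real.pi ^ 2 * (((Fintype.card (Fin 4 × Torus.FrameIdx (Fin 3) N × Bool × Bool) : ℕ) : ℝ) *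
          (1 / 2 + A₁ ^ 2 / 2 + 2 * B₂ ^ 2 + (N : ℝ) ^ 2 * c ^ 2 / 2) +
          16 * ∑ a : Torus.FrameIdx (Fin 3) N, ∑ k ∈ ((Torus.freqBall N).erase 0), Torus.freqNormSq k * ‖(cR a) k‖ ^ 2)) := by
  have hrow : ∀ p, Torus.nsGeneratorPairing ν f (U p) (Torus.fourierTruncate N
      (((U p).1 : Lp (EuclideanSpace ℝ (Fin 3)) 2 (volume : Measure (UnitAddTorus (Fin 3)))) :
        UnitAddTorus (Fin 3) → EuclideanSpace ℝ (Fin 3))) =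
      (∑ k ∈ (Torus.freqBall N).erase 0, (inner ℂ (UnitAddTorus.mFourierCoeff (EuclideanSpace.complexify ∘ f) k)
        ((cf + cA p.1 + cB p.1 + (if p.2.2.1 then (1 : ℝ) else -1) • cC + (if p.2.2.2 then (1 : ℝ) else -1) • cR p.2.1) k)).re) -
        ν * (4 * Real.pi ^ 2 * ∑ k ∈ (Torus.freqBall N).erase 0, Torus.freqNormSq k *
          ‖(cf + cA p.1 + cB p.1 + (if p.2.2.1 then (1 : ℝ) else -1) • cC + (if p.2.2.2 then (1 : ℝ) else -1) • cR p.2.1) k‖ ^ 2) :=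
    fun p => nsGeneratorPairing_fourierTruncate_of_ae_eq (hU p) (design_isConjSymm hcf hcA hcB hcC hcR p)
      (design_isTransversal hcf hcA hcB hcC hcR p) ν hf.integrable
  simp_rw [hrow, hfF]
  rw [Finset.sum_sub_distrib, sum_sum_re_inner_apply_right Finset.univ,
    design_sum_atoms (cf := cf) (cC := cC) (cR := cR) hcA hcB, ← Finset.mul_sum, ← Finset.mul_sum,
    design_sum_enstrophy hcf hcA hcB hcC hN]
  congr 1
  have h1 : ∀ k ∈ (Torus.freqBall N).erase 0,
      (inner ℂ (cf k) ((((Fintype.card (Fin 4 × Torus.FrameIdx (Fin 3) N × Bool × Bool) : ℕ) : ℝ) • cf) k)).re =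
      ((Fintype.card (Fin 4 × Torus.FrameIdx (Fin 3) N × Bool × Bool) : ℕ) : ℝ) * (inner ℂ (cf k) (cf k)).re := by
    intro k _
    rw [Pi.smul_apply, ← Complex.coe_smul, inner_smul_right, Complex.re_ofReal_mul]
  rw [Finset.sum_congr rfl h1, ← Finset.mul_sum, design_sum_re_inner_cf_cf hcf hN]

/-! ## The helicity row -/

include hcf hcA hcB hcC hcR hU hf hfF in
/-- **THE HELICITY ROW OF THE DESIGN VANISHES, summed over the atoms** (the force term is the
helicity form of the linearly polarised force mode, the Stokes term is the averaged helicity form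
`design_sum_curlForm`). [folklore] -/
theorem symDesign_sum_helicityRow (ν : ℝ) :
    ∑ p, Torus.nsGeneratorPairing ν f (U p) (BDSV.curl (Torus.fourierTruncate N
      (((U p).1 : Lp (EuclideanSpace ℝ (Fin 3)) 2 (volume : Measure (UnitAddTorus (Fin 3)))) :
        UnitAddTorus (Fin 3) → EuclideanSpace ℝ (Fin 3)))) = 0 := by
  have hrow : ∀ p, Torus.nsGeneratorPairing ν f (U p) (BDSV.curl (Torus.fourierTruncate N
      (((U p).1 : Lp (EuclideanSpace ℝ (Fin 3)) 2 (volume : Measure (UnitAddTorus (Fin 3)))) :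
        UnitAddTorus (Fin 3) → EuclideanSpace ℝ (Fin 3)))) =
      (∑ k ∈ (Torus.freqBall N).erase 0, (inner ℂ (UnitAddTorus.mFourierCoeff (EuclideanSpace.complexify ∘ f) k)
        (IntermittentBeltrami.curlCoeff
          (cf + cA p.1 + cB p.1 + (if p.2.2.1 then (1 : ℝ) else -1) • cC + (if p.2.2.2 then (1 : ℝ) else -1) • cR p.2.1) k)).re) +
        ν * ∑ k ∈ (Torus.freqBall N).erase 0,
          (inner ℂ ((cf + cA p.1 + cB p.1 + (if p.2.2.1 then (1 : ℝ) else -1) • cC + (if p.2.2.2 then (1 : ℝ) else -1) • cR p.2.1) k)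
            (-(((4 * Real.pi ^ 2 * Torus.freqNormSq k : ℝ) : ℂ) • IntermittentBeltrami.curlCoeff
              (cf + cA p.1 + cB p.1 + (if p.2.2.1 then (1 : ℝ) else -1) • cC + (if p.2.2.2 then (1 : ℝ) else -1) • cR p.2.1) k))).re :=
    fun p => nsGeneratorPairing_curl_fourierTruncate_of_ae_eq (hU p) (design_isConjSymm hcf hcA hcB hcC hcR p)
      (design_isTransversal hcf hcA hcB hcC hcR p) ν hf.integrable
  simp_rw [hrow, hfF]
  rw [Finset.sum_add_distrib, ← Finset.mul_sum]
  -- the Stokes term is the averaged helicity form with weight `-4π²|k|²`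
  have hneg : ∀ (x : (Fin 3 → ℤ) → EuclideanSpace ℂ (Fin 3)) (k : Fin 3 → ℤ),
      -(((4 * Real.pi ^ 2 * Torus.freqNormSq k : ℝ) : ℂ) • IntermittentBeltrami.curlCoeff x k) =
      (-(((4 * Real.pi ^ 2 * Torus.freqNormSq k : ℝ) : ℂ))) • IntermittentBeltrami.curlCoeff x k := fun x k => by
    rw [neg_smul]
  simp_rw [hneg]
  rw [design_sum_curlForm hcf hcA hcB hcC hcR fun k => -(((4 * Real.pi ^ 2 * Torus.freqNormSq k : ℝ) : ℂ)),
    mul_zero, add_zero]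
  -- the force term: `curlCoeff` is additive, the atoms sum to `#ι • cf`, and `cf` is linearly polarised
  rw [Finset.sum_comm]
  simp_rw [← Complex.re_sum, ← inner_sum]
  have hsum : ∀ k, ∑ p : (Fin 4 × Torus.FrameIdx (Fin 3) N × Bool × Bool), IntermittentBeltrami.curlCoeff
      (cf + cA p.1 + cB p.1 + (if p.2.2.1 then (1 : ℝ) else -1) • cC + (if p.2.2.2 then (1 : ℝ) else -1) • cR p.2.1) k =
      IntermittentBeltrami.curlCoeff ((((Fintype.card (Fin 4 × Torus.FrameIdx (Fin 3) N × Bool × Bool) : ℕ) : ℝ)) • cf) k := by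
    intro k
    rw [← design_sum_atoms (cf := cf) (cC := cC) (cR := cR) hcA hcB, curlCoeff_sum]
  simp_rw [hsum]
  subst hcf
  have hsmul : ∀ k, IntermittentBeltrami.curlCoeff ((((Fintype.card (Fin 4 × Torus.FrameIdx (Fin 3) N × Bool × Bool) : ℕ) : ℝ)) •
      (Pi.single (![0, 1, 0] : Fin 3 → ℤ) (((1 / 2 : ℂ)) • EuclideanSpace.complexify (WithLp.toLp 2 ![(1 : ℝ), 0, 0] : EuclideanSpace ℝ (Fin 3))) +
        Pi.single (-(![0, 1, 0] : Fin 3 → ℤ)) ((starRingEnd ℂ) ((1 / 2 : ℂ)) • EuclideanSpace.complexify (WithLp.toLp 2 ![(1 : ℝ), 0, 0] : EuclideanSpace ℝ (Fin 3))) : (Fin 3 → ℤ) → EuclideanSpace ℂ (Fin 3))) k =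
      ((((Fintype.card (Fin 4 × Torus.FrameIdx (Fin 3) N × Bool × Bool) : ℕ) : ℝ) : ℂ)) • IntermittentBeltrami.curlCoeff
      (Pi.single (![0, 1, 0] : Fin 3 → ℤ) (((1 / 2 : ℂ)) • EuclideanSpace.complexify (WithLp.toLp 2 ![(1 : ℝ), 0, 0] : EuclideanSpace ℝ (Fin 3))) +
        Pi.single (-(![0, 1, 0] : Fin 3 → ℤ)) ((starRingEnd ℂ) ((1 / 2 : ℂ)) • EuclideanSpace.complexify (WithLp.toLp 2 ![(1 : ℝ), 0, 0] : EuclideanSpace ℝ (Fin 3))) : (Fin 3 → ℤ) → EuclideanSpace ℂ (Fin 3)) k := fun k => by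
    rw [← Complex.coe_smul, curlCoeff_smul]
  simp_rw [hsmul]
  rw [Complex.re_sum]
  exact sum_re_inner_smul_curlCoeff_polarised _ _ _ _ _ _

/-! ## Separation of atoms by band tests (nondegenerate covariance) -/

/-- **A band test pairing non-trivially with some field pairs non-trivially with some frame field**
(the sibling `exists_frame_pairing_ne_zero`, hypotheses bundled as `IsBandTest`). [folklore] -/
theorem exists_frameFieldIdx_pairing_ne_zero {N : ℕ} {g : UnitAddTorus (Fin 3) → EuclideanSpace ℝ (Fin 3)}
    (hg : IsBandTest N g) (hex : ∃ u : Torus.energySpace (Fin 3), Torus.pairing u.1 g ≠ 0) :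
    ∃ a : Torus.FrameIdx (Fin 3) N, ∫ x, ⟪Torus.frameFieldIdx N a x, g x⟫_ℝ ≠ 0 :=
  exists_frame_pairing_ne_zero N hg.1 hg.2.1 hg.2.2.1 hg.2.2.2 hex

end Rows

/-- **Registered sub-goal `designSymAtoms_exists_frameFieldIdx_pairing_ne_zero` of stub S6′**
(summary of this file's nondegeneracy device): a level-`N` band test pairing non-trivially with some
field of the energy space pairs non-trivially with some Galerkin frame field. [folklore] -/
theorem designSymAtoms_exists_frameFieldIdx_pairing_ne_zero : ∀ (N : ℕ) (g : UnitAddTorus (Fin 3) → EuclideanSpace ℝ (Fin 3)), IsBandTest N g → (∃ u : Torus.energySpace (Fin 3), Torus.pairing u.1 g ≠ 0) → ∃ a : Torus.FrameIdx (Fin 3) N, ∫ x, ⟪Torus.frameFieldIdx N a x, g x⟫_ℝ ≠ 0 :=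
  fun _ _ hg hex => exists_frameFieldIdx_pairing_ne_zero hg hex


end

end Summit.AnomalousDissipation.AnomalousDissipation.Theorems.MomentParityQuarticGate
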